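import Mathlib
import HarnessLib

/-!
# One-insertion correlation LENS and the degree-1 KKT field scale (hubbard-cq negation sizing, EXACT LAW (B))

HONEST FRAMING: first certified bounds; not a superconductivity verdict. Pure real algebra about what a k-pointwise
degree-1 sourced KKT–Nambu test CAN see on one-insertion-representable invariant data; nothing here is a number of
the model, an order parameter or a phase word.

Cell `hubbard-cq` (the CUPRATE QUESTION), lens seat `hubbard-cq-lens-negation-1` g4 (author of every statement and
proof: NEGATION-SIZING v4 §23, scratch file `HOME/lean/OneInsertionLens.negation1.lean` sha16 030a001fda0c5fd2);
landed VERBATIM (namespace and header adapted, the three numerical `example`s packaged as `field_scale_print_faces`)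
by seat `hubbard-cq-p1` (lead RULING 115), next to the cell's `KKTBlindness*.lean`. First readers: negation-1 g4,
critic-1 g4.

Exact CAR bookkeeping (v4 §23(a)): for a translation-, `S^z`-, inversion-invariant U(1)-invariant state of the
`t-t′-U` Hubbard model and one spin species, with `n = n_k ∈ [0,1]`, `ν ∈ [0,1]` the density per spin,
`D = D̂(k)` the Fourier symbol of the density-assisted hopping `ω(c†_{x+r,σ} n_{x,σ̄} c_{x,σ})`, `w = ω(d_k† d_k)` for
`d = (n_{σ̄} c_σ)_k`, `x := D − ν n` its correlation part, and `Δ := ε_k − μ_eff`, `μ_eff := μ − U ν`: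

* the two one-insertion Grams read `n·w ≥ D²` and `(1−n)(ν−w) ≥ (ν−D)²` (hole twin EXACT);
* the degree-1 KKT symbols are `Q^rem = −Δ·n − U x` and `Q^add = Δ(1−n) − U x`;
* the Hermitised Nambu cross entry is `√2·h·g_k`, `|g_k| ≤ 2` with equality at the antinodes.

Proved here (pure real algebra, the matrix-level data abstracted to reals):
`lens` — the Grams force `x² ≤ n(1−n)·ν(1−ν)` (so `|x| ≤ p r`, `p = √(n(1−n))`, `r = √(ν(1−ν)) ≤ ½·½`);
`qrem_mul_qadd_eq_at_edge` — at the lens edge `x = −p r` the EXACT square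
  `Q^rem Q^add = U²ν(1−ν)/4 − (U r(1−2n)/2 − Δ p)²`;
`qrem_mul_qadd_le` — on the whole lens `Q^rem Q^add ≤ U² ν(1−ν)/4`, for every `Δ` (every `ε_k, μ, t′`);
`field_scale_of_block_psd` — if the degree-1 Nambu 2×2 k-block at an antinode (`c = √2·h·2`) satisfies the PSD minor
  `c² ≤ Q^rem Q^add` on lens data then `h² ≤ U² ν(1−ν)/32`, i.e. `h ≤ U√(ν(1−ν))/(4√2)` (`= U/(8√2) ≈ 0.0884·U` at
  `ν = ½`; `0` at `U = 0` = critic-2's U = 0 emptiness): the k-pointwise degree-1 KKT–Nambu test cannot be passed by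
  one-insertion-representable invariant data above that field, and negation-1's F3-LITE SDP (v4 §24) shows it IS passed,
  with margin, essentially up to it; `field_scale_of_grams` — the same from the state-level Gram data;
`corner_cap_sq`, `qrem_le_edge` — the zone-corner cap of the removal symbol.
References: R. B. Griffiths, Phys. Rev. 152 (1966) 240 §II (Gram / Schwarz inequalities of a state); T. Koma, H. Tasaki,
J. Stat. Phys. 76 (1994) 745 §1 (the pair-sourced Hamiltonian).
-/

noncomputable section

namespace Summit.Ventures.CertifiedManyBodySolver.Observables

namespace NegationSizing


/-- LENS. The particle Gram `n w ≥ D²` and the hole Gram `(1-n)(ν-w) ≥ (ν-D)²` with `0 ≤ n ≤ 1`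
force the density-assisted-hopping symbol into the lens `(D − ν n)² ≤ n(1−n)·ν(1−ν)` centred at the
Hartree–Fock value `ν n` (multiply the Grams by `1-n` and `n` and add; no division, no sign condition on `ν`). -/
theorem lens {n ν w D : ℝ} (hn0 : 0 ≤ n) (hn1 : n ≤ 1)
    (hP : D ^ 2 ≤ n * w) (hH : (ν - D) ^ 2 ≤ (1 - n) * (ν - w)) :
    (D - ν * n) ^ 2 ≤ n * (1 - n) * (ν * (1 - ν)) := by
  have h1 : (1 - n) * D ^ 2 ≤ (1 - n) * (n * w) := mul_le_mul_of_nonneg_left hP (by linarith)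
  have h2 : n * (ν - D) ^ 2 ≤ n * ((1 - n) * (ν - w)) := mul_le_mul_of_nonneg_left hH hn0
  nlinarith [h1, h2]

/-- The lens half-width is at most `1/4`: for `n ∈ [0,1]`, `n(1-n)ν(1-ν) ≤ 1/16` (any real `ν`). -/
theorem lens_width_le {n ν : ℝ} (hn0 : 0 ≤ n) (hn1 : n ≤ 1) :
    n * (1 - n) * (ν * (1 - ν)) ≤ 1 / 16 := by
  have ha : 0 ≤ n * (1 - n) := mul_nonneg hn0 (by linarith)
  have hb : n * (1 - n) ≤ 1 / 4 := by nlinarith [sq_nonneg (n - 1/2)]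
  have hc : ν * (1 - ν) ≤ 1 / 4 := by nlinarith [sq_nonneg (ν - 1/2)]
  calc n * (1 - n) * (ν * (1 - ν)) ≤ n * (1 - n) * (1 / 4) := mul_le_mul_of_nonneg_left hc ha
    _ ≤ 1 / 16 := by linarith

/-- EXACT SQUARE at the lower lens edge `x = D − ν n = −p r` (`p² = n(1−n)`, `r² = ν(1−ν)`, any signs):
`Q^rem · Q^add = (−Δ n + U p r)(Δ(1−n) + U p r) = U² ν(1−ν)/4 − (U r (1−2n)/2 − Δ p)²`. -/
theorem qrem_mul_qadd_eq_at_edge (U Δ n ν p r : ℝ) (hp : p ^ 2 = n * (1 - n)) (hr : r ^ 2 = ν * (1 - ν)) :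
    (-Δ * n + U * (p * r)) * (Δ * (1 - n) + U * (p * r))
      = U ^ 2 * (ν * (1 - ν)) / 4 - (U * r * (1 - 2 * n) / 2 - Δ * p) ^ 2 := by
  linear_combination (Δ ^ 2 + U ^ 2 * r ^ 2) * hp + (U ^ 2 / 4) * hr

/-- PRODUCT BOUND on the whole lens: with `|x| ≤ p r` (`p, r ≥ 0`, `p² = n(1−n)`, `r² = ν(1−ν)`),
`Q^rem · Q^add = (−Δ n − U x)(Δ(1−n) − U x) ≤ U² ν(1−ν)/4` for every `Δ` (every `ε_k`, `μ`, `t′`).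
(The product is convex in `x`, so it is maximised at a lens edge, where the exact square applies.) -/
theorem qrem_mul_qadd_le {U Δ n ν x p r : ℝ} (hp : p ^ 2 = n * (1 - n)) (hr : r ^ 2 = ν * (1 - ν))
    (hp0 : 0 ≤ p) (hr0 : 0 ≤ r) (hx1 : x ≤ p * r) (hx2 : -(p * r) ≤ x) :
    (-Δ * n - U * x) * (Δ * (1 - n) - U * x) ≤ U ^ 2 * (ν * (1 - ν)) / 4 := by
  have edgeLo : (-Δ * n - U * (-(p * r))) * (Δ * (1 - n) - U * (-(p * r)))
      = U ^ 2 * (ν * (1 - ν)) / 4 - (U * r * (1 - 2 * n) / 2 - Δ * p) ^ 2 := by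
    linear_combination (Δ ^ 2 + U ^ 2 * r ^ 2) * hp + (U ^ 2 / 4) * hr
  have edgeHi : (-Δ * n - U * (p * r)) * (Δ * (1 - n) - U * (p * r))
      = U ^ 2 * (ν * (1 - ν)) / 4 - (U * r * (1 - 2 * n) / 2 + Δ * p) ^ 2 := by
    linear_combination (Δ ^ 2 + U ^ 2 * r ^ 2) * hp + (U ^ 2 / 4) * hr
  have hpr : 0 ≤ p * r := mul_nonneg hp0 hr0
  rcases le_or_gt 0 (U ^ 2 * (x + p * r) + U * Δ * (2 * n - 1)) with hA | hB
  · -- P(x) ≤ P(p r): P(pr) − P(x) = (pr − x)(U²(x+pr) + UΔ(2n−1)) ≥ 0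
    have key : 0 ≤ (p * r - x) * (U ^ 2 * (x + p * r) + U * Δ * (2 * n - 1)) :=
      mul_nonneg (by linarith) hA
    nlinarith [key, edgeHi, sq_nonneg (U * r * (1 - 2 * n) / 2 + Δ * p)]
  · -- P(x) ≤ P(−p r): P(−pr) − P(x) = (−pr − x)(U²(x−pr) + UΔ(2n−1)) ≥ 0 (both factors ≤ 0)
    have hB' : U ^ 2 * (x - p * r) + U * Δ * (2 * n - 1) ≤ 0 := by nlinarith [sq_nonneg U, hpr]
    have key : 0 ≤ (-(p * r) - x) * (U ^ 2 * (x - p * r) + U * Δ * (2 * n - 1)) :=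
      mul_nonneg_of_nonpos_of_nonpos (by linarith) hB'
    nlinarith [key, edgeLo, sq_nonneg (U * r * (1 - 2 * n) / 2 - Δ * p)]

/-- FIELD SCALE. If the degree-1 Nambu k-block `[[Q^rem, c],[c, Q^add]]` at an antinode (`|g_k| = 2`, cross entry
`c = √2·h·2`) satisfies the PSD minor `c² ≤ Q^rem · Q^add` on lens data, then `h² ≤ U² ν(1−ν)/32`. -/
theorem field_scale_of_block_psd {U Δ n ν x p r h : ℝ} (hp : p ^ 2 = n * (1 - n)) (hr : r ^ 2 = ν * (1 - ν))
    (hp0 : 0 ≤ p) (hr0 : 0 ≤ r) (hx1 : x ≤ p * r) (hx2 : -(p * r) ≤ x)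
    (hpsd : (Real.sqrt 2 * h * 2) ^ 2 ≤ (-Δ * n - U * x) * (Δ * (1 - n) - U * x)) :
    h ^ 2 ≤ U ^ 2 * (ν * (1 - ν)) / 32 := by
  have h2 : Real.sqrt 2 ^ 2 = 2 := Real.sq_sqrt (by norm_num)
  have hc : (Real.sqrt 2 * h * 2) ^ 2 = 8 * h ^ 2 := by rw [mul_pow, mul_pow, h2]; ring
  have := qrem_mul_qadd_le (U := U) (Δ := Δ) hp hr hp0 hr0 hx1 hx2
  nlinarith [hc, this, hpsd]

/-- The same from the state-level data: Grams + `0 ≤ n ≤ 1`, `0 ≤ ν ≤ 1` ⇒ `h² ≤ U² ν(1−ν)/32` whenever the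
antinodal degree-1 Nambu minor holds (`p, r` instantiated by `Real.sqrt`). -/
theorem field_scale_of_grams {U Δ n ν w D h : ℝ} (hn0 : 0 ≤ n) (hn1 : n ≤ 1) (hν0 : 0 ≤ ν) (hν1 : ν ≤ 1)
    (hP : D ^ 2 ≤ n * w) (hH : (ν - D) ^ 2 ≤ (1 - n) * (ν - w))
    (hpsd : (Real.sqrt 2 * h * 2) ^ 2 ≤
      (-Δ * n - U * (D - ν * n)) * (Δ * (1 - n) - U * (D - ν * n))) :
    h ^ 2 ≤ U ^ 2 * (ν * (1 - ν)) / 32 := by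
  have hq : 0 ≤ n * (1 - n) := mul_nonneg hn0 (by linarith)
  have hρ : 0 ≤ ν * (1 - ν) := mul_nonneg hν0 (by linarith)
  set p := Real.sqrt (n * (1 - n)) with hpdef
  set r := Real.sqrt (ν * (1 - ν)) with hrdef
  have hp : p ^ 2 = n * (1 - n) := Real.sq_sqrt hq
  have hr : r ^ 2 = ν * (1 - ν) := Real.sq_sqrt hρ
  have hp0 : 0 ≤ p := Real.sqrt_nonneg _
  have hr0 : 0 ≤ r := Real.sqrt_nonneg _
  have hl := lens hn0 hn1 hP hH
  have hsq : (D - ν * n) ^ 2 ≤ (p * r) ^ 2 := by rw [mul_pow, hp, hr]; exact hl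
  have hpr : 0 ≤ p * r := mul_nonneg hp0 hr0
  have hx1 : D - ν * n ≤ p * r := by nlinarith [hsq, hpr]
  have hx2 : -(p * r) ≤ D - ν * n := by nlinarith [hsq, hpr]
  exact field_scale_of_block_psd hp hr hp0 hr0 hx1 hx2 hpsd

/-- ZONE-CORNER CAP. Where `g_k = 0` (zone diagonal, in particular the corner `(π,π)`) the degree-1 block is diagonal and the
margin is capped by the particle-removal symbol alone: with `Δ = ε_k − μ_eff > 0` and `D̂` anywhere on the lens,
`Q^rem = −Δ n − U x ≤ −Δ n + U p r`, and `−Δ n + (U r) p ≤ (√(Δ² + U²ν(1−ν)) − Δ)/2` (Cauchy–Schwarz on the circle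
`(1−2n)² + (2p)² = 1`). Squared, root-free form: if `0 ≤ 2t + Δ` and `t ≤ −Δ n + B p` (`B = U r`), then `(2t + Δ)² ≤ Δ² + B²`.
At `(U, μ, t′) = (8, 7/4, 0)`, `ν ≈ 0.44`: `Δ_M = 4 − μ + Uν ≈ 5.77`, cap `≈ (√(33.3 + 15.8) − 5.77)/2 ≈ 0.62` = the h-independent
plateau of the F3-LITE margins; at `t′ = −¼` (`ε_M = 5`): `≈ 0.54`; at `U = 0`: `0` (critic-2's «feasible AT MARGIN»). -/
theorem corner_cap_sq {Δ B n p t : ℝ} (hp : p ^ 2 = n * (1 - n))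
    (ht : t ≤ -Δ * n + B * p) (hpos : 0 ≤ 2 * t + Δ) :
    (2 * t + Δ) ^ 2 ≤ Δ ^ 2 + B ^ 2 := by
  -- c := 1 - 2n, s := 2p, c² + s² = 1; 2t + Δ ≤ Δ c + B s ≤ √(Δ²+B²)
  have hcs : (1 - 2 * n) ^ 2 + (2 * p) ^ 2 = 1 := by nlinarith [hp]
  have h1 : 2 * t + Δ ≤ Δ * (1 - 2 * n) + B * (2 * p) := by linarith
  have hCS : (Δ * (1 - 2 * n) + B * (2 * p)) ^ 2 ≤ (Δ ^ 2 + B ^ 2) * ((1 - 2 * n) ^ 2 + (2 * p) ^ 2) := by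
    nlinarith [sq_nonneg (Δ * (2 * p) - B * (1 - 2 * n))]
  rw [hcs, mul_one] at hCS
  have h2 : (2 * t + Δ) ^ 2 ≤ (Δ * (1 - 2 * n) + B * (2 * p)) ^ 2 := by
    have := h1; nlinarith [hpos, this]
  exact h2.trans hCS

/-- The removal symbol on the lens is at most its value at the lower edge: `−Δ n − U x ≤ −Δ n + U (p r)` for `U ≥ 0`, `x ≥ −p r`. -/
theorem qrem_le_edge {Δ U n x p r : ℝ} (hU : 0 ≤ U) (hx2 : -(p * r) ≤ x) :
    -Δ * n - U * x ≤ -Δ * n + U * (p * r) := by nlinarith [mul_le_mul_of_nonneg_left hx2 hU]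

/-- Numerical faces at the print point: `U = 8`, `ν = ½` gives `h² ≤ ½` (`h ≤ 0.7071`); `ν = 7/16` (filling 7/8)
gives `h² ≤ 63/128` (`h ≤ 0.70156`); conversely `h_tree = 0.202` is inside the blind range iff `U² ≥ 32·h²/(ν(1-ν))`,
i.e. `U ≥ 2.2853…` at `ν = ½` (arithmetic only; no certificate, no phase word). -/
theorem field_scale_print_faces :
    (8:ℝ) ^ 2 * ((1/2:ℝ) * (1 - 1/2)) / 32 = 1 / 2 ∧
      (8:ℝ) ^ 2 * ((7/16:ℝ) * (1 - 7/16)) / 32 = 63 / 128 ∧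
      ((32:ℝ) * (0.202:ℝ) ^ 2 / ((1/2:ℝ) * (1 - 1/2)) < (2.2854:ℝ) ^ 2 ∧
        (2.2853:ℝ) ^ 2 < (32:ℝ) * (0.202:ℝ) ^ 2 / ((1/2:ℝ) * (1 - 1/2))) := by
  refine ⟨by norm_num, by norm_num, by norm_num, by norm_num⟩

end NegationSizing

end Summit.Ventures.CertifiedManyBodySolver.Observables

end
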